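import Mathlib
import HarnessLib
import Summits.FinalStateConjecture.FinalStateConjecture.Theses.PhaseMixingCapture
import Literature.Geometry.Lorentzian.KerrData

/-!
# Sketch — first lemmas of two crux ideas for `PhaseMixingCapture.BulkKerrCapture`
(planner crux-ideate, stmt-FinalStateConjecture-10696, round 1, ideator 3). Scratch namespace.

* Card `base-point-uniformity-compactness`:
  `CaptureBody` (the crux's body at fixed exponents/mass/constants/spin, verbatim),
  `bulkKerrCapture_iff` (the crux is `∀ a₁ < 1, ∃ (s,δ,k), ∀ M, ∃ ε C, ∀ |a| ≤ a₁M, CaptureBody …`,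
  by `Iff.rfl`), `CaptureBody.mono` (antitone in `ε`, monotone in `C` — PROVED),
  `LocallyUniformCapture` (the base-point-local form: constants uniform on a neighbourhood of each
  spin, the shape of Hintz arXiv:2606.28253 Remark 13.2), `uniform_of_locally` (abstract Lebesgue-
  number / finite-subcover lemma — PROVED) and `bulk_of_locallyUniform :
  LocallyUniformCapture → BulkKerrCapture` (PROVED).
* Card `area-law-modulus`: `chrMass A J = √(A/16π + 4πJ²/A)` (Christodoulou–Kerr mass of a hole of
  horizon area `A` and angular momentum `J`), `chrMass_kerr` (Kerr saturates: `chrMass (8πM r₊) (aM)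
  = M` — PROVED), `abs_le_chrMass_sq` (`|J| ≤ chrMass A J ^ 2` — PROVED), and the real-variable
  assembly `ThermoModulusAlgebra` (statement only: mass bound + area bound + signed spin-flux bound
  ⇒ the crux's modulus with `√d`, constants uniform for `|a| ≤ a₁M`).
* Card `spin-transport-lebesgue-number`: `uniform_radius_of_continuous_centre` (Lebesgue-number lemma
  with a moving centre in a pseudo-metric space — PROVED): a pointwise-in-the-base-point theorem plus
  continuity of the centre curve `a ↦ K(a)` in the SOURCE's topology gives one radius for all centres.
-/

noncomputable section

open scoped Manifold ContDiff Topology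
open Set Filter Literature.Geometry.Lorentzian

namespace Summit.FinalStateConjecture.FinalStateConjecture.Cruxes.BulkKerrCapture.Ideator3

/-! ### Card `base-point-uniformity-compactness` -/

/-- The body of `BulkKerrCapture` at fixed exponents `(s, δ, k)`, mass `M > 0`, ball radius `ε`,
modulus constant `C` and spin `a` (verbatim from the route file, inner radius `r₀ = M`). -/
def CaptureBody [Kerr.Facts] [Kerr.SliceFacts] (s : ℕ) (δ : ℝ) (k : ℕ) (M : ℝ) (hM : 0 < M)
    (ε C a : ℝ) : Prop :=
  ∀ (D : InitialDataSet 𝓘(ℝ, E3) (Kerr.slice a M)) [D.metric.HasLeviCivita],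
    D.IsVacuumConstraintSolution →
    InitialDataSet.dataWeightedSobolevEDist s δ D (Kerr.data M a M hM.le) < ENNReal.ofReal ε →
    ∀ 𝒟 : VacuumCauchyDevelopment D, 𝒟.IsMaximal →
      ∃ (M' a' : ℝ) (𝒟oc : Set 𝒟.carrier), Kerr.IsSubextremal M' a' ∧
        (∀ [𝒟.metric.HasLeviCivita], ∃ B₀ : Set (Kerr.slice a M), IsCompact B₀ ∧
          ∀ σ : ℝ, 0 < σ → ∃ B₁ : Set (Kerr.slice a M), IsCompact B₁ ∧
            ∀ q ∈ {q : Kerr.slice a M | Kerr.afRadius a M + 1 ≤ ‖(q : E3)‖}, q ∉ B₁ →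
              ∀ (ray : ℝ → 𝒟.carrier) (dom : Set ℝ),
                𝒟.metric.IsNormalisedNullRayFrom 𝒟.timeOrientation 𝒟.embed 𝒟.normal q ray dom →
                  ¬ BddAbove dom ∨ ENNReal.ofReal σ ≤
                    sojournTime ray dom
                      (𝒟.metric.causalFuture 𝒟.timeOrientation (𝒟.embed '' B₀))) ∧
        𝒟.toSpacetime.ConvergesToKerr 𝒟oc M' a' k ∧
        |M' - M| + |a' - a| ≤
          C * √(InitialDataSet.dataWeightedSobolevEDist s δ D (Kerr.data M a M hM.le)).toReal

/-- The crux, refolded through `CaptureBody` (definitional). -/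
theorem bulkKerrCapture_iff :
    Theses.PhaseMixingCapture.BulkKerrCapture ↔
      ∀ [Kerr.Facts] [Kerr.SliceFacts], ∀ a₁ : ℝ, a₁ < 1 → ∃ (s : ℕ) (δ : ℝ) (k : ℕ),
        ∀ (M : ℝ) (hM : 0 < M), ∃ ε > (0 : ℝ), ∃ C : ℝ, ∀ a : ℝ, |a| ≤ a₁ * M →
          CaptureBody s δ k M hM ε C a :=
  Iff.rfl

/-- `CaptureBody` is antitone in the ball radius and monotone in the modulus constant: shrinking
`ε` and enlarging `C` preserves it. (The only two places the constants enter.) -/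
theorem CaptureBody.mono [Kerr.Facts] [Kerr.SliceFacts] {s : ℕ} {δ : ℝ} {k : ℕ} {M : ℝ}
    {hM : 0 < M} {ε ε' C C' a : ℝ} (h : CaptureBody s δ k M hM ε C a) (hε : ε' ≤ ε)
    (hC : C ≤ C') : CaptureBody s δ k M hM ε' C' a := by
  intro D _ hvac hdist 𝒟 hmax
  obtain ⟨M', a', 𝒟oc, h1, h2, h3, h4⟩ :=
    h D hvac (lt_of_lt_of_le hdist (ENNReal.ofReal_le_ofReal hε)) 𝒟 hmax
  exact ⟨M', a', 𝒟oc, h1, h2, h3, h4.trans (mul_le_mul_of_nonneg_right hC (Real.sqrt_nonneg _))⟩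

/-- **Base-point-local capture** (the shape delivered by a perturbative theorem at ONE background
together with Hintz, arXiv:2606.28253, Remark 13.2: "Theorem 13.1 remains valid if … we replace
`b₀` with parameters `b₁` satisfying `|b₁ − b₀| < ε` … the particular choice `r = m₀` of the
interior spacelike boundary … is still acceptable"): for every compact spin range `a₁ < 1` there
are exponents such that for every `M > 0` and every base spin `a₀` with `|a₀| ≤ a₁M` the capture
body holds with ONE pair `(ε, C)` for all spins `a` in a neighbourhood of `a₀` (inner radius fixed
at `r₀ = M`). Equivalent to the crux (`bulk_of_locallyUniform` and the trivial converse). -/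
def LocallyUniformCapture : Prop :=
  ∀ [Kerr.Facts] [Kerr.SliceFacts], ∀ a₁ : ℝ, a₁ < 1 → ∃ (s : ℕ) (δ : ℝ) (k : ℕ),
    ∀ (M : ℝ) (hM : 0 < M), ∀ a₀ ∈ Set.Icc (-(a₁ * M)) (a₁ * M),
      ∃ ρ > (0 : ℝ), ∃ ε > (0 : ℝ), ∃ C : ℝ, ∀ a : ℝ, |a - a₀| < ρ → |a| ≤ a₁ * M →
        CaptureBody s δ k M hM ε C a

/-- **Lebesgue-number lemma** (abstract): a property of a radius `ε`, a constant `C` and a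
parameter `a`, antitone in `ε` and monotone in `C`, which holds with locally constant `(ε, C)` near
every point of a compact parameter set, holds with one `(ε, C)` on the whole set. -/
theorem uniform_of_locally {P : ℝ → ℝ → ℝ → Prop} {K : Set ℝ} (hK : IsCompact K)
    (hmono : ∀ ε ε' C C' a, P ε C a → ε' ≤ ε → C ≤ C' → P ε' C' a)
    (h : ∀ a₀ ∈ K, ∃ ρ > (0 : ℝ), ∃ ε > (0 : ℝ), ∃ C : ℝ, ∀ a, |a - a₀| < ρ → a ∈ K → P ε C a) :
    ∃ ε > (0 : ℝ), ∃ C : ℝ, ∀ a ∈ K, P ε C a := by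
  choose! ρ hρ ε hε C hP using h
  obtain ⟨t, htK, hcover⟩ :=
    hK.elim_nhds_subcover (fun a₀ ↦ Metric.ball a₀ (ρ a₀))
      (fun a₀ ha₀ ↦ Metric.ball_mem_nhds a₀ (hρ a₀ ha₀))
  by_cases ht : t.Nonempty
  · refine ⟨t.inf' ht ε, ?_, t.sup' ht C, ?_⟩
    · obtain ⟨i, hi, hi'⟩ := t.exists_mem_eq_inf' ht ε
      rw [hi']
      exact hε i (htK i hi)
    · intro a ha
      obtain ⟨i, hi, hai⟩ : ∃ i ∈ t, a ∈ Metric.ball i (ρ i) := by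
        simpa only [Set.mem_iUnion, exists_prop] using hcover ha
      have hai' : |a - i| < ρ i := by
        rw [Metric.mem_ball, Real.dist_eq] at hai
        exact hai
      exact hmono _ _ _ _ _ (hP i (htK i hi) a hai' ha) (t.inf'_le ε hi) (t.le_sup' C hi)
  · refine ⟨1, one_pos, 0, fun a ha ↦ ?_⟩
    have : a ∈ ⋃ x ∈ t, Metric.ball x (ρ x) := hcover ha
    simp only [Finset.not_nonempty_iff_eq_empty] at ht
    simp [ht] at this

/-- **The crux from base-point-local capture** — pure compactness of `[-a₁M, a₁M]`: the whole
"uniform on compact spin sets" content of `BulkKerrCapture` beyond a base-point-local theorem is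
this lemma. -/
theorem bulk_of_locallyUniform (hLU : LocallyUniformCapture) :
    Theses.PhaseMixingCapture.BulkKerrCapture := by
  rw [bulkKerrCapture_iff]
  intro _ _ a₁ ha₁
  obtain ⟨s, δ, k, h⟩ := hLU a₁ ha₁
  refine ⟨s, δ, k, fun M hM ↦ ?_⟩
  have hloc : ∀ a₀ ∈ Set.Icc (-(a₁ * M)) (a₁ * M), ∃ ρ > (0 : ℝ), ∃ ε > (0 : ℝ), ∃ C : ℝ,
      ∀ a, |a - a₀| < ρ → a ∈ Set.Icc (-(a₁ * M)) (a₁ * M) → CaptureBody s δ k M hM ε C a := by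
    intro a₀ ha₀
    obtain ⟨ρ, hρ, ε, hε, C, hC⟩ := h M hM a₀ ha₀
    exact ⟨ρ, hρ, ε, hε, C, fun a ha haK ↦ hC a ha (abs_le.2 (Set.mem_Icc.1 haK))⟩
  obtain ⟨ε, hε, C, hall⟩ :=
    uniform_of_locally (P := fun ε C a ↦ CaptureBody s δ k M hM ε C a) isCompact_Icc
      (fun ε ε' C C' a hP hε hC ↦ hP.mono hε hC) hloc
  exact ⟨ε, hε, C, fun a ha ↦ hall a (Set.mem_Icc.2 (abs_le.1 ha))⟩

/-- The converse is trivial (take `ρ = 1` and the crux's global constants). -/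
theorem locallyUniform_of_bulk (hB : Theses.PhaseMixingCapture.BulkKerrCapture) :
    LocallyUniformCapture := by
  rw [bulkKerrCapture_iff] at hB
  intro _ _ a₁ ha₁
  obtain ⟨s, δ, k, h⟩ := hB a₁ ha₁
  refine ⟨s, δ, k, fun M hM a₀ _ ↦ ?_⟩
  obtain ⟨ε, hε, C, hC⟩ := h M hM
  exact ⟨1, one_pos, ε, hε, C, fun a _ ha ↦ hC a ha⟩

/-! ### Card `area-law-modulus` -/

/-- The **Christodoulou–Kerr mass** of a black hole with horizon area `A` and angular momentum
`J`: `M(A, J) = √(A/16π + 4πJ²/A)` (Christodoulou 1970 / Smarr: `M² = M_irr² + J²/(4 M_irr²)`,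
`M_irr² = A/16π`). -/
def chrMass (A J : ℝ) : ℝ := √(A / (16 * Real.pi) + 4 * Real.pi * J ^ 2 / A)

/-- AM–GM: `|J| ≤ M(A,J)²` for `A > 0` (the Kerr bound `|a| ≤ M` in thermodynamic variables). -/
theorem abs_le_chrMass_sq {A : ℝ} (hA : 0 < A) (J : ℝ) : |J| ≤ chrMass A J ^ 2 := by
  unfold chrMass
  have hpi : 0 < Real.pi := Real.pi_pos
  have hnn : 0 ≤ A / (16 * Real.pi) + 4 * Real.pi * J ^ 2 / A := by positivity
  rw [Real.sq_sqrt hnn]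
  rw [div_add_div _ _ (by positivity) hA.ne', le_div_iff₀ (by positivity)]
  have h2 : Real.pi ^ 2 * |J| ^ 2 = Real.pi ^ 2 * J ^ 2 := by rw [sq_abs]
  nlinarith [sq_nonneg (A - 8 * Real.pi * |J|), h2]

/-- **Kerr saturates**: for `0 < M`, `|a| ≤ M`, the hole of area `A = 8π M r₊(M,a)` and angular
momentum `J = aM` has Christodoulou–Kerr mass exactly `M` (uses `r₊² + a² = 2 M r₊`). -/
theorem chrMass_kerr {M a : ℝ} (hM : 0 < M) (ha : |a| ≤ M) :
    chrMass (8 * Real.pi * M * Kerr.rPlus M a) (a * M) = M := by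
  unfold chrMass Kerr.rPlus
  have hpi : 0 < Real.pi := Real.pi_pos
  have ha2 : a ^ 2 ≤ M ^ 2 := by
    rw [← sq_abs a]; exact pow_le_pow_left₀ (abs_nonneg a) ha 2
  have h0 : 0 ≤ M ^ 2 - a ^ 2 := by linarith
  set w := √(M ^ 2 - a ^ 2) with hw
  have hw0 : 0 ≤ w := Real.sqrt_nonneg _
  have hw2 : w ^ 2 = M ^ 2 - a ^ 2 := Real.sq_sqrt h0
  have hr : 0 < M + w := add_pos_of_pos_of_nonneg hM hw0
  have key : 8 * Real.pi * M * (M + w) / (16 * Real.pi) +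
      4 * Real.pi * (a * M) ^ 2 / (8 * Real.pi * M * (M + w)) = M ^ 2 := by
    field_simp
    linear_combination (64 : ℝ) * hw2
  rw [key, Real.sqrt_sq hM.le]

/-- **Thermodynamic modulus algebra** (statement; real variables only). For a compact spin range
`a₁ < 1` and mass `M` the constants below are uniform: if the final sub-extremal parameters
`(M', a')` of a development satisfy (α) `M' ≤ M + C₁ d` (ADM mass pinned by the ball + Bondi mass
loss ≥ 0), (β) `8π M' r₊(M',a') ≥ 8π M r₊(M,a) − C₂ d` (area theorem + outer-minimising MOTS of the
datum), (γ) `a' M' ≥ a M − C₃ d − j` (`z`-angular-momentum balance; `j` = |radiated `J^z`|), then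
`|M' − M| + |a' − a| ≤ C (√d + j)`. The `√d` enters only through the spin-UP direction at small
`a` (no flux can raise `|J|` beyond what the area and mass budgets allow); the Lipschitz constant
of `√(M² − a²)` in `a`, `≤ a₁/√(1 − a₁²)`, is where `a₁ < 1` is used. -/
def ThermoModulusAlgebra : Prop :=
  ∀ (M a₁ C₁ C₂ C₃ : ℝ), 0 < M → 0 ≤ a₁ → a₁ < 1 → 0 ≤ C₁ → 0 ≤ C₂ → 0 ≤ C₃ →
    ∃ d₀ > (0 : ℝ), ∃ C : ℝ, ∀ (a a' M' d j : ℝ),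
      0 ≤ a → a ≤ a₁ * M → 0 ≤ d → d ≤ d₀ → 0 ≤ j → j ≤ d₀ → Kerr.IsSubextremal M' a' →
      M' ≤ M + C₁ * d →
      8 * Real.pi * M * Kerr.rPlus M a - C₂ * d ≤ 8 * Real.pi * M' * Kerr.rPlus M' a' →
      a * M - C₃ * d - j ≤ a' * M' →
        |M' - M| + |a' - a| ≤ C * (√d + j)

/-! ### Card `spin-transport-lebesgue-number` -/

/-- **Lebesgue-number lemma with a moving centre** (abstract form of "transport along the Kerr family
in the SOURCE's topology"): let `κ : ℝ → X` be a curve of centres in a pseudo-metric space (the Kerr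
data `a ↦ K(a)` read in the source theorem's tail-tolerant data topology), continuous on a compact
parameter set `K`, and suppose a property `P` holds on SOME ball around each centre `κ a₀`, `a₀ ∈ K`
(a POINTWISE-in-the-base-point theorem). Then one radius serves every centre `κ a`, `a ∈ K`. The
only input beyond the pointwise theorem is continuity of the centre curve — true in a tail-tolerant
(partially polyhomogeneous) topology, false in `H^s_δ` for `δ ≥ 1/2` (angular-momentum tail). -/
theorem uniform_radius_of_continuous_centre {X : Type*} [PseudoMetricSpace X] {κ : ℝ → X}
    {K : Set ℝ} (hK : IsCompact K) (hκ : ContinuousOn κ K) {P : X → Prop}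
    (h : ∀ a₀ ∈ K, ∃ ε₀ > (0 : ℝ), ∀ x, dist x (κ a₀) < ε₀ → P x) :
    ∃ ε > (0 : ℝ), ∀ a ∈ K, ∀ x, dist x (κ a) < ε → P x := by
  choose! ε₀ hε₀ hP using h
  have hρ : ∀ a₀ ∈ K, ∃ ρ > (0 : ℝ), ∀ a ∈ K, dist a a₀ < ρ → dist (κ a) (κ a₀) < ε₀ a₀ / 2 := by
    intro a₀ ha₀
    exact (Metric.continuousOn_iff.1 hκ) a₀ ha₀ (ε₀ a₀ / 2) (half_pos (hε₀ a₀ ha₀))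
  choose! ρ hρpos hρ using hρ
  obtain ⟨t, htK, hcover⟩ :=
    hK.elim_nhds_subcover (fun a₀ ↦ Metric.ball a₀ (ρ a₀))
      (fun a₀ ha₀ ↦ Metric.ball_mem_nhds a₀ (hρpos a₀ ha₀))
  by_cases ht : t.Nonempty
  · refine ⟨t.inf' ht (fun i ↦ ε₀ i / 2), ?_, ?_⟩
    · obtain ⟨i, hi, hi'⟩ := t.exists_mem_eq_inf' ht (fun i ↦ ε₀ i / 2)
      rw [hi']
      exact half_pos (hε₀ i (htK i hi))
    · intro a ha x hx
      obtain ⟨i, hi, hai⟩ : ∃ i ∈ t, a ∈ Metric.ball i (ρ i) := by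
        simpa only [Set.mem_iUnion, exists_prop] using hcover ha
      have h1 : dist (κ a) (κ i) < ε₀ i / 2 := hρ i (htK i hi) a ha (Metric.mem_ball.1 hai)
      have h2 : dist x (κ a) < ε₀ i / 2 :=
        lt_of_lt_of_le hx (t.inf'_le (fun i ↦ ε₀ i / 2) hi)
      refine hP i (htK i hi) x ?_
      calc dist x (κ i) ≤ dist x (κ a) + dist (κ a) (κ i) := dist_triangle _ _ _
        _ < ε₀ i / 2 + ε₀ i / 2 := add_lt_add h2 h1
        _ = ε₀ i := by ring
  · refine ⟨1, one_pos, fun a ha x _ ↦ ?_⟩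
    have : a ∈ ⋃ x ∈ t, Metric.ball x (ρ x) := hcover ha
    simp only [Finset.not_nonempty_iff_eq_empty] at ht
    simp [ht] at this

end Summit.FinalStateConjecture.FinalStateConjecture.Cruxes.BulkKerrCapture.Ideator3
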